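import Summits.ValiantsHypothesis.ValiantsHypothesis.Theorems.LacunarySymmetroidMatrixDescartesCensusV19SSoundCaseB
import Summits.ValiantsHypothesis.ValiantsHypothesis.Theorems.LacunarySymmetroidMatrixDescartesCensusWindowNSupport
import Summits.ValiantsHypothesis.ValiantsHypothesis.Theorems.LacunarySymmetroidMatrixDescartesCensusNineteenLift

/-!
# `MatrixDescartes` census — soundness of the 2-SIDON `V = 19` checker: a Case-A nineteen yields a model of its cell

HONEST FRAMING.  Object-search cell `pub-symmetroid`; door-A item `DoorA26 = PosRootLawAt 2 6 19`
(stmt-ValiantsHypothesis-19979; OPEN, typed, never asserted).  Part of the proof that certificates accepted by `V19S.certOK` (`…CensusV19SCheck`)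
exclude a nineteen on a 2-Sidon support: if a real symmetric six-term `2 × 2` pencil on a checked 2-Sidon support has `19` distinct positive
det-roots, ALL `21` coefficients non-zero, and exactly one consecutive repetition at positions `(k, k+1)` (Case A — every other consecutive pair
alternating), then its coefficients carry the cell's signs, the Newton-cone rows hold at the alternating consecutive triples
(`Census.nineteen_window_two_six`, window lemma in support form) in the checker's form `V20.rowC25`, the three window balances hold
(`Census.flank_balance_low_support` / `…high_support` / `window_balance_mid_support`) in the checker's vocabulary (`V19S.wterm`, reduced weights
`V19S.redW`), and with the Gram facts this is a `V19S.Model` of the cell `(s, A k)` in branch `none` (`V19S.modelA_of_nineteen`).  That a nineteen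
with no vanishing coefficient IS in Case A (given the `V = 20` row of its support) is the dispatch of `…CensusV19SSoundNineteen`.  Nothing here bears
on the one-collision supports, on `ζ_sym(2,6)` over all supports, on `DoorA26` itself, on `MatrixDescartes` (stmt-ValiantsHypothesis-18050) or on
`VP ≠ VNP`.

[folklore] Certificate-checker soundness; elementary.
-/

-- the D-0017 layout repeats a namespace component (single-conjunct summit); the `dupNamespace` linter flags it; name mandated.
set_option linter.dupNamespace false

namespace Summit.ValiantsHypothesis.ValiantsHypothesis.Theorems.LacunarySymmetroidMatrixDescartes.Census.V19S

open V20 (Atom allAtoms psum posOf ordOK sums qA cA Term PolySpec posl FNat fval Row rowC25 FRat negAt Epos aval qv bv pdet dfun dist1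
  lprod fin6 ordOK_spec Epos_lt Epos_le Epos_posOf posOf_lt sums_nodup sums_getD getD_posOf negAt_succ
  G3poly RCSpoly Wpoly pval qA_mem cA_mem fin6_eq aval_qA aval_cA pval_G3 pval_RCS pval_W tri_pos)
open V19C (triNull_aval)

open Polynomial Finset
open scoped BigOperators Polynomial

section CaseA

variable {dl : List ℕ} {ord : List Atom} {S : Fin 6 → Matrix (Fin 2) (Fin 2) ℝ}

/-! ### Sign bookkeeping of mode `A k` -/

/-- Away from the repetition the cell's signs alternate. [folklore] -/
theorem negSlot_A_succ_of_ne (s : Bool) {k p : ℕ} (hp : p ≠ k) : negSlot s (.A k) (p + 1) = !negSlot s (.A k) p := by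
  unfold negSlot Mode.pivot
  by_cases h1 : p < k
  · rw [if_pos (show p + 1 ≤ k by omega), if_pos (show p ≤ k by omega), negAt_succ]
  · rw [if_neg (show ¬ p + 1 ≤ k by omega), if_neg (show ¬ p ≤ k by omega), negAt_succ, Bool.not_not]

/-- At the repetition the cell's signs repeat. [folklore] -/
theorem negSlot_A_succ_self (s : Bool) (k : ℕ) : negSlot s (.A k) (k + 1) = negSlot s (.A k) k := by
  unfold negSlot Mode.pivot
  rw [if_neg (show ¬ k + 1 ≤ k by omega), if_pos le_rfl, negAt_succ, Bool.not_not]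

/-- Position `0` carries the sign `s`. [folklore] -/
theorem negSlot_A_zero (s : Bool) (k : ℕ) : negSlot s (.A k) 0 = !s := by
  unfold negSlot Mode.pivot negAt; simp

/-- The real sign of a position of a mode-`A k` cell. [folklore] -/
theorem sgR_A {s : Bool} {k : ℕ} {mid : Option ℕ} (p : ℕ) :
    sgR (mkCtx dl ord s (.A k) mid) p = if negSlot s (.A k) p then -1 else 1 := by
  unfold sgR mkCtx zeroSlot; simp

/-! ### The support of a Case-A nineteen -/

/-- A pencil with no vanishing coefficient on the `21` sums has support exactly the sums. [folklore] -/
theorem supportA_eq (h : ordOK dl ord = true) (hall : ∀ t, t < 21 → (pdet dl S).coeff (Epos dl ord t) ≠ 0) :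
    (pdet dl S).support = (sums dl ord).toFinset := by
  refine Finset.Subset.antisymm (support_subset_sums h S) fun e he => ?_
  rw [toFinset_sums h, Finset.mem_image] at he
  obtain ⟨t, ht, rfl⟩ := he
  exact Polynomial.mem_support_iff.2 (hall t (Finset.mem_range.1 ht))

/-- Every sum is in the support. [folklore] -/
theorem Epos_mem_supportA (hall : ∀ t, t < 21 → (pdet dl S).coeff (Epos dl ord t) ≠ 0) {t : ℕ}
    (ht : t < 21) : Epos dl ord t ∈ (pdet dl S).support :=
  Polynomial.mem_support_iff.2 (hall t ht)

/-- The support has `21` elements. [folklore] -/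
theorem card_supportA (h : ordOK dl ord = true) (hall : ∀ t, t < 21 → (pdet dl S).coeff (Epos dl ord t) ≠ 0) :
    (pdet dl S).support.card = 21 := by
  rw [supportA_eq h hall, card_toFinset_sums h]

/-- `pdet` is the determinant of the pencil on `dfun dl` (definitional). [folklore] -/
theorem pdet_eq (dl : List ℕ) (S : Fin 6 → Matrix (Fin 2) (Fin 2) ℝ) :
    pdet dl S = Matrix.det (∑ l, ((Polynomial.X : Polynomial ℝ) ^ dfun dl l) • (S l).map Polynomial.C) := rfl

/-! ### The repetition and the sign pattern -/

/-- With the `V = 20` row of the support, a nineteen with no vanishing coefficient has exactly one repetition: some `k < 20` with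
`c_k c_{k+1} > 0` and every other consecutive pair alternating. [folklore] -/
theorem exists_repetition (h : ordOK dl ord = true) (hS : ∀ l, (S l).IsSymm)
    (h19 : 19 ≤ ((pdet dl S).roots.toFinset.filter (fun t => 0 < t)).card) (h20 : PosRootLawOn 2 6 19 (dfun dl))
    (hall : ∀ t, t < 21 → (pdet dl S).coeff (Epos dl ord t) ≠ 0) :
    ∃ k, k < 20 ∧ 0 < (pdet dl S).coeff (Epos dl ord k) * (pdet dl S).coeff (Epos dl ord (k + 1)) ∧
      ∀ t, t + 1 < 21 → t ≠ k → (pdet dl S).coeff (Epos dl ord t) * (pdet dl S).coeff (Epos dl ord (t + 1)) < 0 := by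
  have hf0 : pdet dl S ≠ 0 := by intro h0; rw [h0] at h19; simp at h19
  have hV := signVariations_le_nineteen_of_posRootLawOn h20 S hS (pdet_eq dl S) h19
  obtain ⟨a, ha, b, hb, hab, hcons, hrep⟩ := exists_consecutive_repetition_of_signVariations_le (pdet dl S) hf0
    (by rw [card_supportA h hall]; omega)
  obtain ⟨k, hk, rfl⟩ := exists_pos_of_mem_support h ha
  obtain ⟨k', hk', rfl⟩ := exists_pos_of_mem_support h hb
  have hkk : k < k' := by
    by_contra hle; push Not at hle
    exact absurd hab (not_lt.2 (Epos_le h hle hk))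
  have hk1 : k' = k + 1 := by
    by_contra hne
    have hlt : k + 1 < k' := by omega
    exact hcons _ (Epos_mem_supportA hall (by omega)) ⟨Epos_lt h (Nat.lt_succ_self k) (by omega), Epos_lt h hlt hk'⟩
  subst hk1
  obtain ⟨hslack, -⟩ := nineteen_window_two_six (dfun dl) S (pdet_eq dl S) h19
  refine ⟨k, by omega, hrep, fun t ht htk => ?_⟩
  have hne : (pdet dl S).coeff (Epos dl ord t) * (pdet dl S).coeff (Epos dl ord (t + 1)) ≠ 0 :=
    mul_ne_zero (hall t (by omega)) (hall (t + 1) ht)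
  rcases lt_trichotomy ((pdet dl S).coeff (Epos dl ord t) * (pdet dl S).coeff (Epos dl ord (t + 1))) 0 with hlt | heq | hgt
  · exact hlt
  · exact absurd heq hne
  · exfalso
    have := consecutive_repetition_unique (pdet dl S) hslack ha hb hab hcons hrep (Epos_mem_supportA hall (by omega))
      (Epos_mem_supportA hall ht) (Epos_lt h (Nat.lt_succ_self t) ht) (no_support_between h ht) hgt
    have hinj : k = t := by
      by_contra hne'
      rcases Nat.lt_or_gt_of_ne hne' with hlt | hlt
      · exact absurd this (ne_of_lt (Epos_lt h hlt (by omega)))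
      · exact absurd this.symm (ne_of_lt (Epos_lt h hlt (by omega)))
    exact htk hinj.symm

/-- **Sign pattern of a Case-A nineteen**: with `s` the sign of the lowest coefficient and the repetition at `(k, k+1)`, the coefficient at
position `p` has the cell's sign `V19S.sgR (s, A k) p`. [folklore] -/
theorem signA (hall : ∀ t, t < 21 → (pdet dl S).coeff (Epos dl ord t) ≠ 0) {k : ℕ}
    (hrep : 0 < (pdet dl S).coeff (Epos dl ord k) * (pdet dl S).coeff (Epos dl ord (k + 1)))
    (halt : ∀ t, t + 1 < 21 → t ≠ k → (pdet dl S).coeff (Epos dl ord t) * (pdet dl S).coeff (Epos dl ord (t + 1)) < 0) :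
    ∀ p, p < 21 → 0 < sgR (mkCtx dl ord (decide (0 < (pdet dl S).coeff (Epos dl ord 0))) (.A k) none) p
      * (pdet dl S).coeff (Epos dl ord p) := by
  intro p
  induction p with
  | zero =>
    intro _
    rw [sgR_A, negSlot_A_zero]
    have hne := hall 0 (by norm_num)
    generalize (pdet dl S).coeff (Epos dl ord 0) = c0 at hne ⊢
    by_cases hc : 0 < c0
    · rw [decide_eq_true hc]; simp [hc]
    · have hlt : c0 < 0 := lt_of_le_of_ne (not_lt.1 hc) hne
      rw [decide_eq_false hc]; simp; linarith
  | succ p ih =>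
    intro hp
    have h1 := ih (by omega)
    rw [sgR_A] at h1 ⊢
    by_cases hpk : p = k
    · subst hpk
      rw [negSlot_A_succ_self]
      exact chain_rep (ite_pm_cases _) h1 hrep
    · rw [negSlot_A_succ_of_ne _ hpk, ite_pm_not]
      exact chain_alt (ite_pm_cases _) h1 (halt p hp hpk)

/-! ### Window balances in the checker's vocabulary -/

/-- The support-form window term at a sum is the checker's window term. [folklore] -/
theorem wterm_eq (h : ordOK dl ord = true) (hall : ∀ t, t < 21 → (pdet dl S).coeff (Epos dl ord t) ≠ 0)
    (s : Bool) (m : Mode) (mid : Option ℕ) (x : ℕ → ℝ) (hx : ∀ t, t < 21 → x t = |(pdet dl S).coeff (Epos dl ord t)|)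
    {w0 : ℕ} (hw : w0 + 3 < 21) {t : ℕ} (ht : t = w0 ∨ t = w0 + 1 ∨ t = w0 + 2 ∨ t = w0 + 3) (y : ℝ) :
    |(pdet dl S).coeff (Epos dl ord t)| *
        (∏ u ∈ (pdet dl S).support, (if u = Epos dl ord w0 ∨ u = Epos dl ord (w0 + 1) ∨ u = Epos dl ord (w0 + 2) ∨ u = Epos dl ord (w0 + 3)
          then (1 : ℝ) else |(Epos dl ord t : ℝ) - u|)) * y ^ (Epos dl ord t)
      = wterm (mkCtx dl ord s m mid) x w0 t y := by
  have ht21 : t < 21 := by omega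
  unfold wterm redWR winSums mkCtx
  simp only
  rw [sums_getD h (by omega), sums_getD h (by omega), sums_getD h (by omega), sums_getD h hw, sums_getD h ht21, hx t ht21,
    supportA_eq h hall, prod_ite4_eq_redW _ (sums_nodup h)]
  rcases ht with rfl | rfl | rfl | rfl <;> simp

/-! ### The model of a Case-A nineteen -/

/-- **A Case-A nineteen yields a model** of the cell `(s, A k)`, `s` = sign of the lowest coefficient, branch `none`. [folklore] -/
theorem modelA_of_nineteen (h : ordOK dl ord = true) (hS : ∀ l, (S l).IsSymm)
    (h19 : 19 ≤ ((pdet dl S).roots.toFinset.filter (fun t => 0 < t)).card)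
    (hall : ∀ t, t < 21 → (pdet dl S).coeff (Epos dl ord t) ≠ 0) {k : ℕ} (hk : k < 20)
    (hrep : 0 < (pdet dl S).coeff (Epos dl ord k) * (pdet dl S).coeff (Epos dl ord (k + 1)))
    (halt : ∀ t, t + 1 < 21 → t ≠ k → (pdet dl S).coeff (Epos dl ord t) * (pdet dl S).coeff (Epos dl ord (t + 1)) < 0) :
    Model (mkCtx dl ord (decide (0 < (pdet dl S).coeff (Epos dl ord 0))) (.A k) none)
      (fun p => if p < 21 then |(pdet dl S).coeff (Epos dl ord p)| else 1) (aval S) := by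
  set s := decide (0 < (pdet dl S).coeff (Epos dl ord 0)) with hs
  set x : ℕ → ℝ := fun p => if p < 21 then |(pdet dl S).coeff (Epos dl ord p)| else 1 with hxdef
  have hx : ∀ t, t < 21 → x t = |(pdet dl S).coeff (Epos dl ord t)| := by
    intro t ht; rw [hxdef]; simp only; rw [if_pos ht]
  have xpos : ∀ t, 0 < x t := by
    intro t; rw [hxdef]; simp only
    split_ifs with ht
    · exact abs_pos.2 (hall t ht)
    · exact one_pos
  obtain ⟨hslack, hwin⟩ := nineteen_window_two_six (dfun dl) S (pdet_eq dl S) h19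
  have hZ3 : (pdet dl S).support.card ≤ ((pdet dl S).roots.toFinset.filter (fun t => 0 < t)).card + 3 := by
    rw [card_supportA h hall]; omega
  have hsgn := signA hall hrep halt
  refine
    { wf := ⟨h, rfl, by simp only [mkCtx, Mode.ok, decide_eq_true_eq]; omega⟩
      xpos := xpos
      hv := ?_
      c25A := ?_
      c25B := fun z t hz => by simp [mkCtx] at hz
      winLow := ?_
      winHigh := ?_
      winMid := ?_
      g3 := fun i j k hij hjk _ => pval_G3 S hij hjk
      rcs := fun i j _ _ hij hq => pval_RCS S hij hq
      w := fun i j k l _ _ _ _ hij hik hil hjk hjl hkl => pval_W S hij hik hil hjk hjl hkl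
      tri := fun i j k hij hjk _ hi hj hk => tri_pos S hij hjk hi hj hk
      triNull := fun n a b _ hab _ hna hnb hn ha hb hne => triNull_aval S hna hab.ne hnb hn ha hb hne }
  · -- hv
    intro a ha
    show aval S a = sgR _ (posOf a ord) * x (posOf a ord)
    have hp := posOf_lt h ha
    rw [← coeff_Epos_posOf h hS ha, hx _ hp]
    have key := hsgn (posOf a ord) hp
    rw [sgR_A] at key ⊢
    exact eq_sgn_mul_abs (ite_pm_cases _) key
  · -- c25A
    intro k' t hk' h1 h19' htk htk1
    simp only [mkCtx, Mode.A.injEq] at hk'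
    subst hk'
    show (rowC25 (sums dl ord) t).Holds x
    have hpq := Epos_lt h (show t - 1 < t by omega) (show t < 21 by omega)
    have hqr := Epos_lt h (show t < t + 1 by omega) (show t + 1 < 21 by omega)
    have halt1 : (pdet dl S).coeff (Epos dl ord (t - 1)) * (pdet dl S).coeff (Epos dl ord t) < 0 := by
      have := halt (t - 1) (by omega) (by omega)
      rwa [show t - 1 + 1 = t by omega] at this
    have halt2 := halt t (by omega) htk
    have key := hwin (Epos_mem_supportA hall (show t - 1 < 21 by omega)) (Epos_mem_supportA hall (show t < 21 by omega))
      (Epos_mem_supportA hall (show t + 1 < 21 by omega)) hpq hqr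
      (by have := no_support_between h (S := S) (t := t - 1) (by omega); rwa [show t - 1 + 1 = t by omega] at this)
      (no_support_between h (by omega)) halt1 halt2
    rw [supportA_eq h hall, prod_ite_abs_eq _ (sums_nodup h), prod_ite_abs_eq _ (sums_nodup h), prod_ite_abs_eq _ (sums_nodup h),
      ← hx (t - 1) (by omega), ← hx t (by omega), ← hx (t + 1) (by omega)] at key
    exact rowC25_holds_of_ineq _ t x (sums_getD h (by omega)) (sums_getD h (by omega)) (sums_getD h (by omega)) hpq hqr key
  · -- winLow
    intro k' hk' h2
    simp only [mkCtx, Mode.A.injEq] at hk'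
    subst hk'
    have e0 : k - 2 + 1 = k - 1 := by omega
    have e1 : k - 2 + 2 = k := by omega
    have e2 : k - 2 + 3 = k + 1 := by omega
    obtain ⟨y, hy, hbal⟩ := flank_balance_low_support (pdet dl S) hZ3
      (Epos_mem_supportA hall (show k - 2 < 21 by omega)) (Epos_mem_supportA hall (show k - 1 < 21 by omega))
      (Epos_mem_supportA hall (show k < 21 by omega)) (Epos_mem_supportA hall (show k + 1 < 21 by omega))
      (Epos_lt h (by omega) (by omega)) (Epos_lt h (by omega) (by omega)) (Epos_lt h (by omega) (by omega))
      (by have := no_support_between h (S := S) (t := k - 2) (by omega); rwa [e0] at this)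
      (by have := no_support_between h (S := S) (t := k - 1) (by omega); rwa [show k - 1 + 1 = k by omega] at this)
      (no_support_between h (by omega))
      (by have := halt (k - 2) (by omega) (by omega); rwa [e0] at this)
      (by have := halt (k - 1) (by omega) (by omega); rwa [show k - 1 + 1 = k by omega] at this)
      hrep
    refine ⟨y, hy, ?_⟩
    have W := fun (t : ℕ) (ht : t = k - 2 ∨ t = k - 2 + 1 ∨ t = k - 2 + 2 ∨ t = k - 2 + 3) =>
      wterm_eq h hall s (.A k) none x hx (w0 := k - 2) (by omega) ht y
    rw [e0, e1, e2] at W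
    rw [← W (k - 1) (by omega), ← W (k - 2) (by omega), ← W k (by omega), ← W (k + 1) (by omega)]
    exact hbal
  · -- winHigh
    intro k' hk' h3
    simp only [mkCtx, Mode.A.injEq] at hk'
    subst hk'
    obtain ⟨y, hy, hbal⟩ := flank_balance_high_support (pdet dl S) hZ3
      (Epos_mem_supportA hall (show k < 21 by omega)) (Epos_mem_supportA hall (show k + 1 < 21 by omega))
      (Epos_mem_supportA hall (show k + 2 < 21 by omega)) (Epos_mem_supportA hall (show k + 3 < 21 by omega))
      (Epos_lt h (by omega) (by omega)) (Epos_lt h (by omega) (by omega)) (Epos_lt h (by omega) (by omega))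
      (no_support_between h (by omega)) (no_support_between h (by omega)) (no_support_between h (by omega))
      hrep (halt (k + 1) (by omega) (by omega)) (halt (k + 2) (by omega) (by omega))
    refine ⟨y, hy, ?_⟩
    have W := fun (t : ℕ) (ht : t = k ∨ t = k + 1 ∨ t = k + 2 ∨ t = k + 3) =>
      wterm_eq h hall s (.A k) none x hx (w0 := k) (by omega) ht y
    rw [← W (k + 2) (by omega), ← W k (by omega), ← W (k + 1) (by omega), ← W (k + 3) (by omega)]
    exact hbal
  · -- winMid
    intro k' hk' h1 h2
    simp only [mkCtx, Mode.A.injEq] at hk'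
    subst hk'
    have e0 : k - 1 + 1 = k := by omega
    have e1 : k - 1 + 2 = k + 1 := by omega
    have e2 : k - 1 + 3 = k + 2 := by omega
    obtain ⟨y, hy, hbal⟩ := window_balance_mid_support (pdet dl S) hZ3
      (Epos_mem_supportA hall (show k - 1 < 21 by omega)) (Epos_mem_supportA hall (show k < 21 by omega))
      (Epos_mem_supportA hall (show k + 1 < 21 by omega)) (Epos_mem_supportA hall (show k + 2 < 21 by omega))
      (Epos_lt h (by omega) (by omega)) (Epos_lt h (by omega) (by omega)) (Epos_lt h (by omega) (by omega))
      (by have := no_support_between h (S := S) (t := k - 1) (by omega); rwa [e0] at this)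
      (no_support_between h (by omega)) (no_support_between h (by omega))
      (by have := halt (k - 1) (by omega) (by omega); rwa [e0] at this)
      hrep (halt (k + 1) (by omega) (by omega))
    refine ⟨y, hy, ?_, fun hm => by simp [mkCtx] at hm, fun hm => by simp [mkCtx] at hm⟩
    have W := fun (t : ℕ) (ht : t = k - 1 ∨ t = k - 1 + 1 ∨ t = k - 1 + 2 ∨ t = k - 1 + 3) =>
      wterm_eq h hall s (.A k) none x hx (w0 := k - 1) (by omega) ht y
    rw [e0, e1, e2] at W
    rw [← W (k - 1) (by omega), ← W (k + 2) (by omega), ← W k (by omega), ← W (k + 1) (by omega)]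
    exact hbal

end CaseA

end Summit.ValiantsHypothesis.ValiantsHypothesis.Theorems.LacunarySymmetroidMatrixDescartes.Census.V19S
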